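import Literature.Claims.NS.Mitrovic2024
import Mathlib.Analysis.Complex.ExponentialBounds
import HarnessLib

/-!
# C74 `Mitrovic2024` (D-0090 NS-CLAIMS SWEEP) — the inference (26) ⇒ (27) «by the Gronwall inequality» is false

D. Mitrović, *Viscosity under infinite acceleration assumptions and Navier Stokes equations*, arXiv:2411.02568v1
(2024), proof of Theorem 3, p. 8 (TeX l. 540–552): from the Volterra inequality (26)
`‖u(t)‖_∞ ≤ ‖u₀‖_∞ + C₁∫₀ᵗ e^{−(t−s)}‖u(s)‖_∞ ds + ε^{3/4}C₂(1 − e^{−t})` the print concludes the `t`-UNIFORM bound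
(27) `‖u(t)‖_∞ ≤ (‖u₀‖_∞ + ε^{3/4}C₂) e^{C₁(1−e^{−t})} ≤ (‖u₀‖_∞ + C₂)e^{C₁}`. The kernel `C₁e^{−(t−s)}` is a MEMORY
kernel, not a Gronwall weight. Three kernel-checked facts, all pure real arithmetic (no Navier–Stokes object):

* `not_Gronwall2627` — the typed Step 2 is false: witness `ε = C₁ = a = 1`, `C₂ = 0`, `f(t) = 1 + t` satisfies (26)
  with equality (`∫₀ᵗ e^{−(t−s)}(1+s) ds = t`) and violates (27) at `t = 2`. `C₁ = 1` is the print's own value: the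
  `L¹` norm (25) of the positive Bessel kernel of `(I−Δ)⁻¹`, whose integral is its Fourier symbol at `0`.
* `bound26_unbounded_at_unit_mass` — at that kernel mass `C₁ = 1`, (26) does not even yield BOUNDEDNESS, for every
  datum size `a > 0`, every `C₂ ≥ 0` and every `ε ≥ 0`: `f(t) = a(1+t)` obeys (26). So Theorem 3's conclusion (a bound
  independent of `t`) cannot be extracted from (26) by any constant — the step has no repair at the inequality grain.
* `not_bound27_at_half_mass` — the DISPLAY (27) is wrong even where a uniform bound does hold: for `C₁ = 1/2`
  (`a = ε = 1`, `C₂ = 0`) the function `f(t) = 2 − e^{−t/2}` satisfies (26) with equality and exceeds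
  `e^{C₁(1−e^{−t})} ≤ e^{1/2}` at `t = 4`; the sharp constant for the memory kernel of mass `C₁ < 1` is `1/(1−C₁) > e^{C₁}`
  (the exponent `C₁(1−e^{−t}) = ∫₀ᵗ C₁e^{−(t−s)}ds` is Gronwall's bound for a weight that must not depend on `t`).

Typed locator: `Literature.Claims.NS.Mitrovic2024.Gronwall2627` (Step 2 of the skeleton p480936, typist-2 g2; REF C74
ref-3 g2 2026-08-27T01:25:37Z: faithful yes). Theorem 4 (l. 560) consumes exactly the `t`-uniformity (skeleton:
`rescale_needs_uniformity`). Authorship: `memory_integral`, `bound26_witness`, `not_bound27_witness`, `not_Gronwall2627`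
are typist-2 g2's kill-aid (kit sha16 e78248da5806d5df) adopted verbatim by the refuter of record (refuter-7); the two
companion theorems are refuter-7's. Filed by the salvage seat unchanged (cell convention (b)).

WHAT THIS IS NOT: not a claim about NS regularity or blow-up; not a claim about any author beyond
the typed locator.
-/

set_option linter.dupNamespace false

noncomputable section

open Set MeasureTheory intervalIntegral

namespace Summit.NavierStokesRegularity.NavierStokesRegularity.Theorems.Mitrovic2024

open Literature.Claims.NS.Mitrovic2024

/-- `∫₀ᵗ e^{−(t−s)} (1+s) ds = t` (FTC with `F(s) = s·e^{s−t}`): the memory integral of (26) at the witness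
`f = 1 + t`. [cite: Mitrovic2024, (26) p.8] -/
theorem memory_integral (t : ℝ) :
    ∫ s in (0 : ℝ)..t, Real.exp (-(t - s)) * (1 + s) = t := by
  have hderiv : ∀ s ∈ Set.uIcc (0 : ℝ) t,
      HasDerivAt (fun s : ℝ => s * Real.exp (s - t)) (Real.exp (-(t - s)) * (1 + s)) s := by
    intro s _
    have h2 : HasDerivAt (fun s : ℝ => Real.exp (s - t)) (Real.exp (s - t)) s := by
      simpa using ((hasDerivAt_id s).sub_const t).exp
    have h3 : HasDerivAt (fun s : ℝ => s * Real.exp (s - t)) (1 * Real.exp (s - t) + s * Real.exp (s - t)) s :=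
      (hasDerivAt_id' s).mul h2
    refine h3.congr_deriv ?_
    rw [show -(t - s) = s - t by ring]
    ring
  have hcont : Continuous fun s : ℝ => Real.exp (-(t - s)) * (1 + s) := by fun_prop
  rw [integral_eq_sub_of_hasDerivAt hderiv (hcont.intervalIntegrable _ _)]
  simp

/-- The witness `f = 1 + t` satisfies (26) with `ε = C₁ = a = 1`, `C₂ = 0` (with equality). [cite: Mitrovic2024, (26) p.8] -/
theorem bound26_witness : Bound26 1 1 0 1 (fun t => 1 + t) := by
  intro t ht
  rw [memory_integral t]
  simp

/-- The witness violates (27) at `t = 2`: `3 ≤ e^{1 − e^{−2}}` is false since `e^{1−e^{−2}} ≤ e < 3`.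
[cite: Mitrovic2024, (27) p.8] -/
theorem not_bound27_witness : ¬ Bound27 1 1 0 1 (fun t => 1 + t) := by
  intro h
  have h2 := h 2 (by norm_num)
  simp only [mul_zero, add_zero, one_mul] at h2
  norm_num at h2
  have hlt : Real.exp (1 - Real.exp (-2)) < 3 := by
    have hpos : 0 < Real.exp (-2 : ℝ) := Real.exp_pos _
    have h1 : Real.exp (1 - Real.exp (-2)) ≤ Real.exp 1 :=
      Real.exp_le_exp.2 (by linarith)
    have he : Real.exp 1 < 3 := by
      have := Real.exp_one_lt_d9; linarith
    linarith
  linarith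

/-- **Step 2 of the C74 skeleton is false**: the printed inference (26) ⇒ (27) "by the Gronwall inequality"
(Theorem 3 proof p. 8, l. 549–552) fails for the scalar witness `ε = C₁ = a = 1`, `C₂ = 0`, `f(t) = 1 + t` — a
continuous nonnegative function satisfying the Volterra inequality (26) (with equality: the memory kernel
`e^{−(t−s)}` has mass `1 − e^{−t}`, and `C₁ = 1` is the print's own constant, the `L¹` norm of the positive Bessel
kernel of `(I−Δ)⁻¹`) but not the `t`-uniform bound (27). [claim: Mitrovic2024, status: disputed] -/
theorem not_Gronwall2627 : ¬ Literature.Claims.NS.Mitrovic2024.Gronwall2627 := by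
  intro H
  have hcont : ContinuousOn (fun t : ℝ => 1 + t) (Ici 0) := by fun_prop
  have h := H 1 1 0 1 (fun t => 1 + t) one_pos le_rfl one_pos le_rfl zero_le_one hcont
    (fun t ht => by linarith) bound26_witness
  exact not_bound27_witness h

/-- **No repair by changing the constant in (27)**: at the print's kernel mass `C₁ = 1`, the Volterra inequality
(26) is satisfied by the linearly growing `f(t) = a(1 + t)` for EVERY datum size `a > 0`, every `C₂ ≥ 0` and every
`ε ≥ 0` — a continuous nonnegative function on `[0,∞)` that is not bounded. Hence Theorem 3's conclusion ("bounded
independently of `ε` and `t > 0`") does not follow from (26) with any bound whatsoever.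
[cite: Mitrovic2024, (26)–(27) p.8] -/
theorem bound26_unbounded_at_unit_mass {ε C₂ a : ℝ} (hε : 0 ≤ ε) (hC₂ : 0 ≤ C₂) (ha : 0 < a) :
    ContinuousOn (fun t : ℝ => a * (1 + t)) (Ici 0) ∧ (∀ t : ℝ, 0 ≤ t → 0 ≤ a * (1 + t)) ∧
      Literature.Claims.NS.Mitrovic2024.Bound26 ε 1 C₂ a (fun t => a * (1 + t)) ∧
      ∀ M : ℝ, ∃ t : ℝ, 0 ≤ t ∧ M < a * (1 + t) := by
  refine ⟨by fun_prop, fun t ht => by positivity, fun t ht => ?_, fun M => ?_⟩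
  · have hint : ∫ s in (0 : ℝ)..t, Real.exp (-(t - s)) * (a * (1 + s)) = a * t := by
      have hswap : (fun s : ℝ => Real.exp (-(t - s)) * (a * (1 + s)))
          = fun s : ℝ => a * (Real.exp (-(t - s)) * (1 + s)) := by
        funext s; ring
      rw [hswap, intervalIntegral.integral_const_mul, memory_integral t]
    rw [hint]
    have h1 : 0 ≤ ε ^ (3 / 4 : ℝ) := Real.rpow_nonneg hε _
    have h2 : 0 ≤ 1 - Real.exp (-t) := by
      have : Real.exp (-t) ≤ 1 := Real.exp_le_one_iff.2 (by linarith)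
      linarith
    have h3 : 0 ≤ ε ^ (3 / 4 : ℝ) * C₂ * (1 - Real.exp (-t)) := by positivity
    linarith
  · refine ⟨|M| / a, by positivity, ?_⟩
    have hM : M ≤ |M| := le_abs_self M
    have hcalc : a * (1 + |M| / a) = a + |M| := by
      field_simp
    rw [hcalc]
    linarith

/-- `∫₀ᵗ e^{−(t−s)} (2 − e^{−s/2}) ds = 2 − 2e^{−t/2}` (FTC with `F(s) = 2e^{s−t} − 2e^{s/2−t}`): the memory integral
of (26) at the half-mass witness. [cite: Mitrovic2024, (26) p.8] -/
theorem memory_integral_half (t : ℝ) :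
    ∫ s in (0 : ℝ)..t, Real.exp (-(t - s)) * (2 - Real.exp (-(s / 2))) = 2 - 2 * Real.exp (-(t / 2)) := by
  have hderiv : ∀ s ∈ Set.uIcc (0 : ℝ) t,
      HasDerivAt (fun s : ℝ => 2 * Real.exp (s - t) - 2 * Real.exp (s / 2 - t))
        (Real.exp (-(t - s)) * (2 - Real.exp (-(s / 2)))) s := by
    intro s _
    have h2 : HasDerivAt (fun s : ℝ => Real.exp (s - t)) (Real.exp (s - t) * 1) s := by
      simpa using ((hasDerivAt_id s).sub_const t).exp
    have h3 : HasDerivAt (fun s : ℝ => Real.exp (s / 2 - t)) (Real.exp (s / 2 - t) * (1 / 2)) s := by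
      have h3a : HasDerivAt (fun s : ℝ => s / 2 - t) (1 / 2) s := by
        simpa using ((hasDerivAt_id s).div_const 2).sub_const t
      exact h3a.exp
    have h4 := (h2.const_mul 2).sub (h3.const_mul 2)
    refine h4.congr_deriv ?_
    have hprod : Real.exp (-(t - s)) * Real.exp (-(s / 2)) = Real.exp (s / 2 - t) := by
      rw [← Real.exp_add]; congr 1; ring
    rw [show -(t - s) = s - t by ring] at hprod ⊢
    rw [mul_sub, hprod]
    ring
  have hcont : Continuous fun s : ℝ => Real.exp (-(t - s)) * (2 - Real.exp (-(s / 2))) := by fun_prop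
  rw [integral_eq_sub_of_hasDerivAt hderiv (hcont.intervalIntegrable _ _)]
  simp only [sub_self, Real.exp_zero, zero_div, zero_sub]
  rw [show t / 2 - t = -(t / 2) by ring]
  ring

/-- **The display (27) is wrong even below the critical mass**: for `C₁ = 1/2` (`a = ε = 1`, `C₂ = 0`) the function
`f(t) = 2 − e^{−t/2}` satisfies (26) with equality but violates (27) at `t = 4`
(`2 − e^{−2} > 1.86 > e^{1/2} ≥ e^{(1/2)(1−e^{−4})}`). For a memory kernel of mass `C₁ < 1` the sharp uniform constant
is `1/(1−C₁)` (here `2`), strictly larger than the printed `e^{C₁}`; the printed exponent is Gronwall's bound for a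
`t`-independent weight, which `C₁e^{−(t−s)}` is not. [cite: Mitrovic2024, (26)–(27) p.8] -/
theorem not_bound27_at_half_mass :
    Literature.Claims.NS.Mitrovic2024.Bound26 1 (1 / 2) 0 1 (fun t => 2 - Real.exp (-(t / 2))) ∧
      ¬ Literature.Claims.NS.Mitrovic2024.Bound27 1 (1 / 2) 0 1 (fun t => 2 - Real.exp (-(t / 2))) := by
  refine ⟨fun t ht => ?_, fun h => ?_⟩
  · rw [memory_integral_half t]
    simp only [mul_zero, zero_mul, add_zero]
    linarith
  · have h4 := h 4 (by norm_num)
    simp only [mul_zero, add_zero, one_mul] at h4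
    -- `e^{(1/2)(1 − e^{−4})} ≤ e^{1/2} < 1.65` and `e^{−2} < 0.14`
    have hE1 : Real.exp ((1 / 2 : ℝ) * (1 - Real.exp (-4))) ≤ Real.exp (1 / 2) :=
      Real.exp_le_exp.2 (by nlinarith [Real.exp_pos (-4 : ℝ)])
    have hE2 : Real.exp (1 / 2 : ℝ) < 1.65 := by
      by_contra hcon
      have hge : 1.65 ≤ Real.exp (1 / 2 : ℝ) := le_of_not_gt hcon
      have hsq : Real.exp (1 / 2 : ℝ) * Real.exp (1 / 2) = Real.exp 1 := by
        rw [← Real.exp_add]; norm_num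
      have h165 : (1.65 : ℝ) * 1.65 ≤ Real.exp 1 := by
        rw [← hsq]; exact mul_le_mul hge hge (by norm_num) (Real.exp_pos _).le
      have := Real.exp_one_lt_d9
      norm_num at h165
      linarith
    have hE3 : Real.exp (-2 : ℝ) < 0.14 := by
      have hprod : Real.exp (-2 : ℝ) * Real.exp 2 = 1 := by
        rw [← Real.exp_add]; norm_num
      have he2 : 7.29 < Real.exp (2 : ℝ) := by
        have hsq : Real.exp (1 : ℝ) * Real.exp 1 = Real.exp 2 := by
          rw [← Real.exp_add]; norm_num
        have hgt := Real.exp_one_gt_d9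
        nlinarith
      have hpos : 0 < Real.exp (-2 : ℝ) := Real.exp_pos _
      nlinarith
    have h42 : -((4 : ℝ) / 2) = -2 := by norm_num
    rw [h42] at h4
    linarith

/-- Cross-reference for the refutes index: the companion facts packaged as one negation-shaped statement — it is NOT
the case that (26) with the print's kernel mass `C₁ = 1` forces boundedness on `[0,∞)` (instance `a = 1`, `C₂ = 0`,
`ε = 1`). [cite: Mitrovic2024, (26)–(27) p.8] -/
theorem not_bound26_forces_bounded :
    ¬ (∀ f : ℝ → ℝ, ContinuousOn f (Ici 0) → (∀ t : ℝ, 0 ≤ t → 0 ≤ f t) →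
        Literature.Claims.NS.Mitrovic2024.Bound26 1 1 0 1 f → ∃ M : ℝ, ∀ t : ℝ, 0 ≤ t → f t ≤ M) := by
  intro H
  obtain ⟨hc, hnn, h26, hunb⟩ :=
    bound26_unbounded_at_unit_mass (ε := 1) (C₂ := 0) (a := 1) zero_le_one le_rfl one_pos
  obtain ⟨M, hM⟩ := H _ hc hnn h26
  obtain ⟨t, ht, hlt⟩ := hunb M
  exact absurd (hM t ht) (not_le.2 hlt)

end Summit.NavierStokesRegularity.NavierStokesRegularity.Theorems.Mitrovic2024

end
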